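import Mathlib.RingTheory.Ideal.MinimalPrime.Noetherian
import Literature.ModelTheory.Zilber.EACProofs
import Literature.NumberTheory.Transcendental.ExpVarietiesDimension
import HarnessLib

/-!
# Aslanyan–Kirby–Mantova 2023 Thm. 1.5 (Brownawell–Masser for arbitrary algebraic `V`), proved

Discharges the NAMED FACT `aslanyanKirbyMantova2023_thm_1_5` of `EAC.lean` — "an algebraic
subvariety `W ⊆ ℂⁿ × 𝔾ₘⁿ` with dominant projection to `ℂⁿ` contains a point `(z̄, exp z̄)`", with NO
irreducibility or dimension hypothesis — from the tree THEOREM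
`Literature.NumberTheory.Transcendental.BrownawellMasser2017_dominantProjection_holds`
(the irreducible, `dim W = n` case: Brownawell–Masser, JLMS 95 (2017) Prop. 2, fully proved in the
tree). After this file the fact is a theorem (`aslanyanKirbyMantova2023_thm_1_5_holds`); it is the
printed form attributed by Aslanyan–Kirby–Mantova (IMRN 2023, Thm. 1.5) to Brownawell–Masser, and the
reduction below is the one-line remark of Mantova–Masser 2024 §1 ("if the dimension is `n' > n` then
life just gets simpler and we can adjoin `n' − n` suitably chosen equations") carried out in
coordinates, with COORDINATE DOUBLING in place of hyperplane sections (so that no fibre-dimension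
theory is needed):

1. `exists_isMinimalPrime_of_hasDominantAddProjection` — some irreducible component `Z(P)` of the
   Zariski closure of `V = W ∩ (ℂⁿ × (ℂˣ)ⁿ)` still projects dominantly and is not contained in a
   coordinate hyperplane `Yᵢ = 0` (prime avoidance: otherwise a product of non-zero `x`-polynomials
   times a monomial in the `Yᵢ` would vanish on `V`, and the `Yᵢ` do not vanish on the torus);
2. `hasDominantAddProjection_zeroLocus` — such a component meets the torus and its torus part projects
   dominantly (generic points, `vanishingIdeal_zeroLocus_inter_torusLocus`);
3. `exists_doubling` — if `trdeg ℂ(Z(P)) > n`, some multiplicative coordinate class `ȳᵢ` is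
   transcendental over the (algebraically independent) additive classes `x̄` (a transcendence basis
   between `x̄` and all coordinate classes, `exists_isTranscendenceBasis_between`); the prime
   `P₁ = ker (ℂ[X₀..Xₙ, Y₀..Yₙ] → ℂ[Z(P)], X ↦ (x̄, ȳᵢ), Y ↦ (ȳ, ȳᵢ))` defines a subvariety of
   `ℂⁿ⁺¹ × ℂⁿ⁺¹` with the SAME coordinate ring, no `x`-relation, no `Yⱼ` in it, and every point
   `(z, w, exp z, exp w)` of it restricts to a point `(z, exp z)` of `Z(P)`; so the defect
   `trdeg − n` drops by one;
4. `zeroLocus_inter_expGraph_nonempty_of_trdeg` — induction on the defect down to `dim = n`, where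
   `BrownawellMasser2017_dominantProjection_holds` applies (`zariskiDim_zeroLocus_eq_trdeg`).

Honest framing (cell pub-schanuel): this settles a bookkeeping debt of the EAC case ladder (one named
fact fewer); it is NOT a rung of Exponential-Algebraic Closedness beyond Brownawell–Masser, NOT the open
cell `ECCell 3 2`, and has no bearing on Schanuel's conjecture (EAC ⇏ SC; Aslanyan–Gallinaro 2024 §3.5).

## References
* V. Aslanyan, J. Kirby, V. Mantova, *A geometric approach to some systems of exponential equations*,
  IMRN 2023 (arXiv:2105.12679), Thm. 1.5 (p. 4).
* W. D. Brownawell, D. W. Masser, *Zero estimates with moving targets*, JLMS 95 (2017) 441–454, Prop. 2.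
* V. Mantova, D. Masser, *Polynomial-exponential equations — some new cases of solvability*, PLMS 129
  (2024) e12627 (arXiv:2303.05592), §1 (p. 3: the remark on dimension `n' > n`).
-/

noncomputable section

open MvPolynomial

namespace Literature.ModelTheory.Zilber

open Literature.NumberTheory.Transcendental

variable {n : ℕ}

/-! ### Step 1 — a dominant irreducible component off the coordinate hyperplanes -/

/-- The vanishing ideal of a set of points is radical. [folklore] -/
theorem radical_vanishingIdeal {K : Type*} [Field K] {ι : Type*} (S : Set (ι → K)) :
    (vanishingIdeal K S).radical = vanishingIdeal K S := by
  refine le_antisymm (fun p hp => ?_) Ideal.le_radical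
  obtain ⟨k, hk⟩ := Ideal.mem_radical_iff.mp hp
  rw [mem_vanishingIdeal_iff] at hk ⊢
  intro z hz
  have h := hk z hz
  rw [map_pow] at h
  exact eq_zero_of_pow_eq_zero h

/-- **Prime avoidance for the dominant component.** If `V ⊆ ℂⁿ × (ℂˣ)ⁿ` has dominant additive
projection, then some minimal prime `P` over `I(V)` (an irreducible component `Z(P)` of the Zariski
closure of `V`) contains no non-zero polynomial in the additive coordinates alone and none of the
multiplicative coordinates `Yᵢ`. Otherwise choose, for each of the finitely many minimal primes, either
such an `x`-polynomial `f_P ≠ 0` or a `Yᵢ ∈ P`; the product lies in every minimal prime, hence in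
`√I(V) = I(V)`; the `Yᵢ` do not vanish on `V`, so `∏ f_P` vanishes on `π(V)`, i.e. `∏ f_P = 0`.
[folklore] -/
theorem exists_isMinimalPrime_of_hasDominantAddProjection {V : Set (Fin n ⊕ Fin n → ℂ)}
    (hV : V ⊆ torusLocus ℂ n) (hdom : HasDominantAddProjection ℂ V) :
    ∃ P ∈ (vanishingIdeal ℂ V).minimalPrimes,
      (∀ p : MvPolynomial (Fin n) ℂ, rename Sum.inl p ∈ P → p = 0) ∧
      ∀ i, (X (Sum.inr i) : MvPolynomial (Fin n ⊕ Fin n) ℂ) ∉ P := by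
  classical
  have hfin : (vanishingIdeal ℂ V).minimalPrimes.Finite :=
    Ideal.finite_minimalPrimes_of_isNoetherianRing _ (vanishingIdeal ℂ V)
  by_contra hcon
  push Not at hcon
  have hchoice : ∀ P ∈ (vanishingIdeal ℂ V).minimalPrimes, ∃ f : MvPolynomial (Fin n) ℂ,
      ∃ m : MvPolynomial (Fin n ⊕ Fin n) ℂ, f ≠ 0 ∧ (∀ z ∈ torusLocus ℂ n, aeval z m ≠ 0) ∧
        rename Sum.inl f * m ∈ P := by
    intro P hPm
    by_cases hx : ∀ p : MvPolynomial (Fin n) ℂ, rename Sum.inl p ∈ P → p = 0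
    · obtain ⟨i, hi⟩ := hcon P hPm hx
      refine ⟨1, X (Sum.inr i), one_ne_zero, fun z hz => ?_, by simpa using hi⟩
      rw [aeval_X]
      exact (mem_torusLocus_iff.mp hz) i
    · push Not at hx
      obtain ⟨p, hp, hp0⟩ := hx
      exact ⟨p, 1, hp0, fun z _ => by simp, by simpa using hp⟩
  choose! f m hf0 hm hfm using hchoice
  have hmem : ∀ P, P ∈ hfin.toFinset ↔ P ∈ (vanishingIdeal ℂ V).minimalPrimes :=
    fun P => hfin.mem_toFinset
  -- the product of the chosen witnesses lies in every minimal prime, hence in `I(V) = √I(V)`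
  have hG : (∏ P ∈ hfin.toFinset, (rename Sum.inl (f P) * m P)) ∈ vanishingIdeal ℂ V := by
    have hGrad : (∏ P ∈ hfin.toFinset, (rename Sum.inl (f P) * m P)) ∈
        (vanishingIdeal ℂ V).radical := by
      rw [← Ideal.sInf_minimalPrimes, Submodule.mem_sInf]
      intro P hPm
      obtain ⟨c, hc⟩ :=
        Finset.dvd_prod_of_mem (fun Q => rename Sum.inl (f Q) * m Q) ((hmem P).mpr hPm)
      rw [hc]
      exact Ideal.mul_mem_right _ _ (hfm P hPm)
    rwa [radical_vanishingIdeal] at hGrad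
  have hf0' : (∏ P ∈ hfin.toFinset, f P) ≠ 0 :=
    Finset.prod_ne_zero_iff.mpr fun P hP => hf0 P ((hmem P).mp hP)
  -- the monomial factor does not vanish on the torus, so the `x`-factor vanishes on `V`
  have hfJ : rename Sum.inl (∏ P ∈ hfin.toFinset, f P) ∈ vanishingIdeal ℂ V := by
    rw [mem_vanishingIdeal_iff]
    intro z hz
    have h1 := (mem_vanishingIdeal_iff.mp hG) z hz
    have h1' : aeval z (rename Sum.inl (∏ P ∈ hfin.toFinset, f P)) *
        aeval z (∏ P ∈ hfin.toFinset, m P) = 0 := by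
      simpa only [map_mul, map_prod, Finset.prod_mul_distrib] using h1
    have h2 : aeval z (∏ P ∈ hfin.toFinset, m P) ≠ 0 := by
      rw [map_prod]
      exact Finset.prod_ne_zero_iff.mpr fun P hP => hm P ((hmem P).mp hP) z (hV hz)
    exact (mul_eq_zero.mp h1').resolve_right h2
  have h3 : (∏ P ∈ hfin.toFinset, f P) ∈ vanishingIdeal ℂ (projAdd '' V) :=
    (mem_vanishingIdeal_image_projAdd_iff V _).mpr hfJ
  rw [(hasDominantAddProjection_iff_vanishingIdeal_eq_bot V).mp hdom, Ideal.mem_bot] at h3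
  exact hf0' h3

/-! ### Step 2 — the component meets the torus and projects dominantly -/

/-- If the prime `P` contains none of the multiplicative coordinates `Yᵢ`, then `Z(P)` meets the torus:
otherwise `∏ Yᵢ` vanishes on `Z(P)`, so lies in `I(Z(P)) = P` (Nullstellensatz), and primality puts
some `Yᵢ` in `P`. [folklore] -/
theorem zeroLocus_inter_torusLocus_nonempty_of_X_inr_notMem
    (P : Ideal (MvPolynomial (Fin n ⊕ Fin n) ℂ)) [P.IsPrime]
    (hY : ∀ i, (X (Sum.inr i) : MvPolynomial (Fin n ⊕ Fin n) ℂ) ∉ P) :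
    (zeroLocus ℂ P ∩ torusLocus ℂ n).Nonempty := by
  by_contra hne
  rw [Set.not_nonempty_iff_eq_empty] at hne
  have h1 : (∏ i : Fin n, X (Sum.inr i) : MvPolynomial (Fin n ⊕ Fin n) ℂ) ∈
      vanishingIdeal ℂ (zeroLocus ℂ P) := by
    rw [mem_vanishingIdeal_iff]
    intro z hz
    have hzT : z ∉ torusLocus ℂ n := by
      intro h
      have hmem : z ∈ zeroLocus ℂ P ∩ torusLocus ℂ n := ⟨hz, h⟩
      rw [hne] at hmem
      exact hmem
    simp only [mem_torusLocus_iff, not_forall, not_not] at hzT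
    obtain ⟨i, hi⟩ := hzT
    rw [map_prod]
    exact Finset.prod_eq_zero (Finset.mem_univ i) (by simpa using hi)
  rw [MvPolynomial.IsPrime.vanishingIdeal_zeroLocus (K := ℂ) P] at h1
  obtain ⟨i, -, hi⟩ := Ideal.IsPrime.prod_mem_iff.mp h1
  exact hY i hi

/-- If the prime `P` contains no non-zero `x`-polynomial and no `Yᵢ`, then the torus part of `Z(P)`
has dominant additive projection: an `x`-polynomial vanishing on `π(Z(P) ∩ T)` lies, after renaming,
in `I(Z(P) ∩ T) = P`. [folklore] -/
theorem hasDominantAddProjection_zeroLocus (P : Ideal (MvPolynomial (Fin n ⊕ Fin n) ℂ)) [P.IsPrime]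
    (hx : ∀ p : MvPolynomial (Fin n) ℂ, rename Sum.inl p ∈ P → p = 0)
    (hY : ∀ i, (X (Sum.inr i) : MvPolynomial (Fin n ⊕ Fin n) ℂ) ∉ P) :
    HasDominantAddProjection ℂ (zeroLocus ℂ P ∩ torusLocus ℂ n) := by
  rw [hasDominantAddProjection_iff_vanishingIdeal_eq_bot, eq_bot_iff]
  intro p hp
  rw [Ideal.mem_bot]
  apply hx
  rw [← vanishingIdeal_zeroLocus_inter_torusLocus P
    (zeroLocus_inter_torusLocus_nonempty_of_X_inr_notMem P hY)]
  exact (mem_vanishingIdeal_image_projAdd_iff _ p).mp hp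

/-! ### Step 3 — coordinate doubling -/

/-- Evaluation at the coordinate classes of `ℂ[σ]/P` is the quotient map. [folklore] -/
theorem aeval_mk_X {σ : Type*} (P : Ideal (MvPolynomial σ ℂ)) (q : MvPolynomial σ ℂ) :
    aeval (fun s => Ideal.Quotient.mk P (X s)) q = Ideal.Quotient.mk P q := by
  have h : (aeval fun s => Ideal.Quotient.mk P (X s)) = Ideal.Quotient.mkₐ ℂ P :=
    MvPolynomial.algHom_ext fun s => by simp
  rw [h]
  rfl

/-- If `P` contains no non-zero `x`-polynomial, the additive coordinate classes `x̄ᵢ` of `ℂ[x, y]/P`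
are algebraically independent over `ℂ`. [folklore] -/
theorem algebraicIndependent_mk_X_inl (P : Ideal (MvPolynomial (Fin n ⊕ Fin n) ℂ))
    (hx : ∀ p : MvPolynomial (Fin n) ℂ, rename Sum.inl p ∈ P → p = 0) :
    AlgebraicIndependent ℂ (fun j : Fin n => Ideal.Quotient.mk P (X (Sum.inl j))) := by
  rw [algebraicIndependent_iff]
  intro p hp
  apply hx
  rw [← Ideal.Quotient.eq_zero_iff_mem, ← aeval_mk_X P, aeval_rename]
  exact hp

/-- `Fin.snoc x a` is injective when `x` is and `a` is a new value. [folklore] -/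
theorem snoc_injective_of_notMem_range {α : Type*} {x : Fin n → α} (hx : Function.Injective x)
    {a : α} (ha : a ∉ Set.range x) : Function.Injective (Fin.snoc x a : Fin (n + 1) → α) := by
  intro p q hpq
  induction p using Fin.lastCases with
  | last =>
    induction q using Fin.lastCases with
    | last => rfl
    | cast j =>
      simp only [Fin.snoc_last, Fin.snoc_castSucc] at hpq
      exact absurd ⟨j, hpq.symm⟩ ha
  | cast j =>
    induction q using Fin.lastCases with
    | last =>
      simp only [Fin.snoc_last, Fin.snoc_castSucc] at hpq
      exact absurd ⟨j, hpq⟩ ha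
    | cast j' =>
      simp only [Fin.snoc_castSucc] at hpq
      rw [hx hpq]

/-- **Coordinate doubling.** Let `P ⊂ ℂ[x₁..xₙ, y₁..yₙ]` be a prime with no non-zero `x`-polynomial,
no `Yᵢ`, and `trdeg_ℂ (ℂ[x, y]/P) > n`. Then some class `ȳᵢ` is transcendental over `ℂ(x̄)`, and the
kernel `P₁` of `ℂ[X₀..Xₙ, Y₀..Yₙ] → ℂ[x, y]/P`, `X ↦ (x̄, ȳᵢ)`, `Y ↦ (ȳ, ȳᵢ)` (the ideal of the
subvariety `{(x, yᵢ, y, yᵢ)} ⊆ ℂⁿ⁺¹ × ℂⁿ⁺¹`) is a prime with the same three properties one dimension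
up and the SAME transcendence degree, whose exponential points restrict to exponential points of
`Z(P)`. This is the coordinate form of Mantova–Masser's remark that for `dim V > n` one adjoins
equations to come down to the Brownawell–Masser case. [cite: MantovaMasser2023, §1 (p. 3)] -/
theorem exists_doubling (P : Ideal (MvPolynomial (Fin n ⊕ Fin n) ℂ)) [hP : P.IsPrime]
    (hx : ∀ p : MvPolynomial (Fin n) ℂ, rename Sum.inl p ∈ P → p = 0)
    (hY : ∀ i, (X (Sum.inr i) : MvPolynomial (Fin n ⊕ Fin n) ℂ) ∉ P)
    (htr : n < Cardinal.toNat (Algebra.trdeg ℂ (MvPolynomial (Fin n ⊕ Fin n) ℂ ⧸ P))) :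
    ∃ P₁ : Ideal (MvPolynomial (Fin (n + 1) ⊕ Fin (n + 1)) ℂ), P₁.IsPrime ∧
      (∀ p : MvPolynomial (Fin (n + 1)) ℂ, rename Sum.inl p ∈ P₁ → p = 0) ∧
      (∀ i, (X (Sum.inr i) : MvPolynomial (Fin (n + 1) ⊕ Fin (n + 1)) ℂ) ∉ P₁) ∧
      Cardinal.toNat (Algebra.trdeg ℂ (MvPolynomial (Fin (n + 1) ⊕ Fin (n + 1)) ℂ ⧸ P₁)) =
        Cardinal.toNat (Algebra.trdeg ℂ (MvPolynomial (Fin n ⊕ Fin n) ℂ ⧸ P)) ∧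
      ∀ z ∈ zeroLocus ℂ P₁ ∩ expGraph ℂ (n + 1),
        z ∘ Sum.map Fin.castSucc Fin.castSucc ∈ zeroLocus ℂ P ∩ expGraph ℂ n := by
  classical
  haveI : IsDomain (MvPolynomial (Fin n ⊕ Fin n) ℂ ⧸ P) := Ideal.Quotient.isDomain P
  haveI : Algebra.FiniteType ℂ (MvPolynomial (Fin n ⊕ Fin n) ℂ ⧸ P) :=
    Algebra.FiniteType.of_surjective (Ideal.Quotient.mkₐ ℂ P) (Ideal.Quotient.mkₐ_surjective ℂ P)
  -- coordinate classes
  set cls : Fin n ⊕ Fin n → MvPolynomial (Fin n ⊕ Fin n) ℂ ⧸ P :=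
    fun s => Ideal.Quotient.mk P (X s) with hcls
  have haeval : ∀ q, aeval cls q = Ideal.Quotient.mk P q := aeval_mk_X P
  have hxind : AlgebraicIndependent ℂ (cls ∘ Sum.inl) := algebraicIndependent_mk_X_inl P hx
  have hy0 : ∀ i, cls (Sum.inr i) ≠ 0 := fun i h => hY i (Ideal.Quotient.eq_zero_iff_mem.mp h)
  have hfin : Algebra.trdeg ℂ (MvPolynomial (Fin n ⊕ Fin n) ℂ ⧸ P) =
      Cardinal.toNat (Algebra.trdeg ℂ (MvPolynomial (Fin n ⊕ Fin n) ℂ ⧸ P)) :=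
    Literature.RingTheory.KrullDimension.trdeg_eq_toNat ℂ _
  -- a transcendence basis among the coordinate classes containing the `x`-classes
  have htop : Algebra.adjoin ℂ (Set.range cls) = ⊤ := by
    rw [Algebra.adjoin_range_eq_range_aeval, AlgHom.range_eq_top]
    intro a
    obtain ⟨q, rfl⟩ := Ideal.Quotient.mk_surjective a
    exact ⟨q, haeval q⟩
  haveI : Algebra.IsAlgebraic (Algebra.adjoin ℂ (Set.range cls))
      (MvPolynomial (Fin n ⊕ Fin n) ℂ ⧸ P) :=
    ⟨fun a => isAlgebraic_algebraMap
      (⟨a, by rw [htop]; exact Algebra.mem_top⟩ : Algebra.adjoin ℂ (Set.range cls))⟩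
  obtain ⟨u, hsu, hut, hu⟩ := exists_isTranscendenceBasis_between (R := ℂ)
    (Set.range (cls ∘ Sum.inl)) (Set.range cls) (Set.range_comp_subset_range _ _)
    hxind.to_subtype_range
  -- `u` has `trdeg > n` elements, so it contains a class outside the `x`-classes: a `y`-class
  have hcard : Cardinal.mk u =
      (Cardinal.toNat (Algebra.trdeg ℂ (MvPolynomial (Fin n ⊕ Fin n) ℂ ⧸ P)) : Cardinal) := by
    rw [hu.cardinalMk_eq_trdeg]
    exact hfin
  have hnot : ¬ (u ⊆ Set.range (cls ∘ Sum.inl)) := by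
    intro h
    have h1 : Cardinal.mk u ≤ Cardinal.mk (Set.range (cls ∘ Sum.inl)) :=
      Cardinal.mk_le_mk_of_subset h
    have h2 : Cardinal.mk (Set.range (cls ∘ Sum.inl)) ≤ n := by
      simpa using (Cardinal.mk_range_le (f := cls ∘ Sum.inl))
    have h3 := (hcard.symm.le.trans h1).trans h2
    norm_cast at h3
    omega
  obtain ⟨a, hau, has⟩ := Set.not_subset.mp hnot
  obtain ⟨σ, rfl⟩ := hut hau
  obtain ⟨i, rfl⟩ : ∃ i, σ = Sum.inr i := by
    rcases σ with j | i
    · exact absurd ⟨j, rfl⟩ has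
    · exact ⟨i, rfl⟩
  -- the doubled additive coordinates `(x̄, ȳᵢ)` are algebraically independent
  set w : Fin (n + 1) → MvPolynomial (Fin n ⊕ Fin n) ℂ ⧸ P :=
    Fin.snoc (cls ∘ Sum.inl) (cls (Sum.inr i)) with hw
  have hw_mem : ∀ p, w p ∈ u := by
    intro p
    induction p using Fin.lastCases with
    | last => rw [hw, Fin.snoc_last]; exact hau
    | cast j => rw [hw, Fin.snoc_castSucc]; exact hsu ⟨j, rfl⟩
  have hw_inj : Function.Injective w :=
    snoc_injective_of_notMem_range hxind.injective has
  have hwind : AlgebraicIndependent ℂ w :=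
    (algebraicIndependent_subtype_range hw_inj).mp (hu.1.mono (Set.range_subset_iff.mpr hw_mem))
  -- the doubled point `ξ₁ = (x̄, ȳᵢ ; ȳ, ȳᵢ)` and its ideal
  set ξ₁ : Fin (n + 1) ⊕ Fin (n + 1) → MvPolynomial (Fin n ⊕ Fin n) ℂ ⧸ P :=
    Sum.elim w (Fin.snoc (cls ∘ Sum.inr) (cls (Sum.inr i))) with hξ₁
  have hoc : ξ₁ ∘ Sum.map Fin.castSucc Fin.castSucc = cls := by
    funext s
    rcases s with j | j
    · simp [hξ₁, hw, Fin.snoc_castSucc]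
    · simp [hξ₁, Fin.snoc_castSucc]
  have hφoc : ∀ q : MvPolynomial (Fin n ⊕ Fin n) ℂ,
      aeval ξ₁ (rename (Sum.map Fin.castSucc Fin.castSucc) q) = Ideal.Quotient.mk P q := by
    intro q
    rw [aeval_rename, hoc, haeval]
  have hφsurj : Function.Surjective (aeval ξ₁ : MvPolynomial (Fin (n + 1) ⊕ Fin (n + 1)) ℂ →ₐ[ℂ]
      MvPolynomial (Fin n ⊕ Fin n) ℂ ⧸ P) := by
    intro a
    obtain ⟨q, rfl⟩ := Ideal.Quotient.mk_surjective a
    exact ⟨_, hφoc q⟩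
  refine ⟨RingHom.ker (aeval ξ₁ : MvPolynomial (Fin (n + 1) ⊕ Fin (n + 1)) ℂ →ₐ[ℂ]
      MvPolynomial (Fin n ⊕ Fin n) ℂ ⧸ P), RingHom.ker_isPrime _, ?_, ?_, ?_, ?_⟩
  · -- no non-zero polynomial in the doubled additive coordinates
    intro p hp
    rw [RingHom.mem_ker, aeval_rename] at hp
    have hp' : aeval w p = 0 := by rwa [hξ₁, Sum.elim_comp_inl] at hp
    exact (algebraicIndependent_iff.mp hwind) p hp'
  · -- no doubled multiplicative coordinate lies in the ideal
    intro j hj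
    rw [RingHom.mem_ker, aeval_X, hξ₁, Sum.elim_inr] at hj
    induction j using Fin.lastCases with
    | last => rw [Fin.snoc_last] at hj; exact hy0 i hj
    | cast j => rw [Fin.snoc_castSucc] at hj; exact hy0 j hj
  · -- same coordinate ring, same transcendence degree
    have h := congrArg Cardinal.toNat (Ideal.quotientKerAlgEquivOfSurjective hφsurj).lift_trdeg_eq
    simpa only [Cardinal.toNat_lift] using h
  · -- exponential points restrict
    rintro z ⟨hzP, hzE⟩
    refine ⟨?_, ?_⟩
    · rw [mem_zeroLocus_iff]
      intro q hq
      have h1 : rename (Sum.map Fin.castSucc Fin.castSucc) q ∈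
          RingHom.ker (aeval ξ₁ : MvPolynomial (Fin (n + 1) ⊕ Fin (n + 1)) ℂ →ₐ[ℂ]
            MvPolynomial (Fin n ⊕ Fin n) ℂ ⧸ P) := by
        rw [RingHom.mem_ker, hφoc q, Ideal.Quotient.eq_zero_iff_mem]
        exact hq
      have h2 := (mem_zeroLocus_iff.mp hzP) _ h1
      rwa [aeval_rename] at h2
    · rw [mem_expGraph_iff] at hzE ⊢
      intro j
      exact hzE (Fin.castSucc j)

/-! ### Step 4 — induction on the defect `trdeg − n` -/

/-- For a prime `P ⊂ ℂ[x, y]` with no non-zero `x`-polynomial and no `Yᵢ`, `Z(P)` contains a point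
`(z, exp z)`: by induction on `k = trdeg ℂ[x,y]/P − n`, the base `k = 0` (`dim Z(P) = n`) being
Brownawell–Masser 2017 Prop. 2 (`BrownawellMasser2017_dominantProjection_holds`) and the step being
coordinate doubling (`exists_doubling`). [cite: BrownawellMasser2017, Prop. 2 (p. 448)] -/
theorem zeroLocus_inter_expGraph_nonempty_of_trdeg (k : ℕ) :
    ∀ (n : ℕ) (P : Ideal (MvPolynomial (Fin n ⊕ Fin n) ℂ)), P.IsPrime →
      (∀ p : MvPolynomial (Fin n) ℂ, rename Sum.inl p ∈ P → p = 0) →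
      (∀ i, (X (Sum.inr i) : MvPolynomial (Fin n ⊕ Fin n) ℂ) ∉ P) →
      Cardinal.toNat (Algebra.trdeg ℂ (MvPolynomial (Fin n ⊕ Fin n) ℂ ⧸ P)) = n + k →
      (zeroLocus ℂ P ∩ expGraph ℂ n).Nonempty := by
  induction k with
  | zero =>
    intro n P hP hx hY htr
    haveI : P.IsPrime := hP
    have hdim : zariskiDim ℂ (zeroLocus ℂ P) = n := by
      rw [zariskiDim_zeroLocus_eq_trdeg P, htr, Nat.add_zero]
    exact BrownawellMasser2017_dominantProjection_holds n (zeroLocus ℂ P)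
      (isIrreducibleClosed_zeroLocus P) hdim (hasDominantAddProjection_zeroLocus P hx hY)
  | succ k ih =>
    intro n P hP hx hY htr
    haveI : P.IsPrime := hP
    obtain ⟨P₁, hP₁, hx₁, hY₁, htr₁, hback⟩ := exists_doubling P hx hY (by omega)
    obtain ⟨z, hz⟩ := ih (n + 1) P₁ hP₁ hx₁ hY₁ (by rw [htr₁, htr]; ring)
    exact ⟨_, hback z hz⟩

/-- **Aslanyan–Kirby–Mantova 2023, Theorem 1.5, proved** (IMRN 2023 = arXiv:2105.12679, Thm. 1.5, p. 4;
there attributed to Brownawell–Masser, JLMS 95 (2017) Prop. 2): an algebraic subvariety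
`W ⊆ ℂⁿ × 𝔾ₘⁿ` whose projection to `ℂⁿ` is dominant contains a point `(z̄, exp z̄)` — with no
irreducibility or dimension hypothesis. Reduction to the tree theorem
`BrownawellMasser2017_dominantProjection_holds` (irreducible, `dim = n`): a dominant irreducible
component off the hyperplanes `Yᵢ = 0` (`exists_isMinimalPrime_of_hasDominantAddProjection`), then
induction on `trdeg − n` by coordinate doubling (`zeroLocus_inter_expGraph_nonempty_of_trdeg`). This
discharges the named fact `aslanyanKirbyMantova2023_thm_1_5` of `EAC.lean`.
[cite: AslanyanKirbyMantova2021, Thm. 1.5 (p. 4)] -/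
theorem aslanyanKirbyMantova2023_thm_1_5_holds : aslanyanKirbyMantova2023_thm_1_5 := by
  intro n W hW hdom
  obtain ⟨P, hPmin, hx, hY⟩ :=
    exists_isMinimalPrime_of_hasDominantAddProjection Set.inter_subset_right hdom
  haveI hP : P.IsPrime := Ideal.IsMinimalPrime.isPrime hPmin
  have hJP : vanishingIdeal ℂ (W ∩ torusLocus ℂ n) ≤ P := Ideal.IsMinimalPrime.le hPmin
  -- the component `Z(P)` lies in `W`
  have hsub : zeroLocus ℂ P ⊆ W := by
    rw [eq_zeroLocus_vanishingIdeal_of_isZariskiClosed hW]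
    exact zeroLocus_anti_mono ((vanishingIdeal_anti_mono Set.inter_subset_left).trans hJP)
  -- its transcendence degree is at least `n` (the `x`-classes are independent)
  haveI : IsDomain (MvPolynomial (Fin n ⊕ Fin n) ℂ ⧸ P) := Ideal.Quotient.isDomain P
  haveI : Algebra.FiniteType ℂ (MvPolynomial (Fin n ⊕ Fin n) ℂ ⧸ P) :=
    Algebra.FiniteType.of_surjective (Ideal.Quotient.mkₐ ℂ P) (Ideal.Quotient.mkₐ_surjective ℂ P)
  have hle : n ≤ Cardinal.toNat (Algebra.trdeg ℂ (MvPolynomial (Fin n ⊕ Fin n) ℂ ⧸ P)) := by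
    have h := (algebraicIndependent_mk_X_inl P hx).lift_cardinalMk_le_trdeg
    rw [Cardinal.mk_fin, Cardinal.lift_natCast,
      Literature.RingTheory.KrullDimension.trdeg_eq_toNat ℂ (MvPolynomial (Fin n ⊕ Fin n) ℂ ⧸ P),
      Cardinal.lift_natCast] at h
    exact_mod_cast h
  obtain ⟨z, hzP, hzE⟩ := zeroLocus_inter_expGraph_nonempty_of_trdeg
    (Cardinal.toNat (Algebra.trdeg ℂ (MvPolynomial (Fin n ⊕ Fin n) ℂ ⧸ P)) - n) n P hP hx hY
    (by omega)
  exact ⟨z, hsub hzP, hzE⟩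

end Literature.ModelTheory.Zilber
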